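import Summits.BirchSwinnertonDyer.BirchSwinnertonDyer.Theorems.CyclotomicUntwistF1OfGrowth
import Mathlib.NumberTheory.DirichletCharacter.Bounds
import HarnessLib

/-!
# F1 ⟸ GROWTH, curve level, and the ORDER-ONE bound that IS formal: the explicit untwisted candidate has
# `HasGrowthOrder p 1` from bounded `f`-symbols alone — the content of F1 is exactly the half step `1 ↦ ½`

Cell `pub/bsd-wall` (D-0145 line `route-BirchSwinnertonDyer-CyclotomicUntwist`), seat `bsd-line-cycu-p1`
(prover seat 1/3, K1 base), helper toward crux K1 `PSRankOneLowerHalfAtThree`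
(stmt-BirchSwinnertonDyer-21580). THEOREMS ONLY (no definition, no named fact, no `sorry`); BSD is not
proved by this file and no crux is.

* §1 `isPSCyclotomicLFunctionOf_of_hasGrowthOrder` — the route's D1 predicate for a Weierstrass curve:
  `IsNewformOf W f` + the explicit candidate of `CyclotomicUntwistF1OfGrowth` (p = 3, η primitive mod 9,
  α ∉ {0, 3}) + `HasGrowthOrder 3 ½ 𝓛` ⟹ `IsPSCyclotomicLFunctionOf W η α 𝓛`.
* §2 `hasGrowthOrder_one_candidate` — UNCONDITIONALLY on bounded symbols: if `‖[r]⁺_f‖₃ ≤ B` for all `r`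
  (Manin–Drinfeld uniform denominators; the tree's `UniformDenominators` section of
  `PAdicLFunctionDistributionProofs` for rational newforms) and `‖p‖ ≤ ‖α‖` (slope `≤ 1`), then the
  candidate has `HasGrowthOrder p 1 𝓛`: each term `α^{-j} p^{j−M} S_j` of `ν_M` has norm
  `≤ ‖α⁻¹p‖^j p^M B ≤ p^M B` and the constant term `p^M ‖(1−α/p)⁻¹‖ B` (ultrametric maxima throughout).
  So the formal construction gives order `1`; D1 wants order `½ = v_p(α)`; the gap is the cancellation in
  `∑_j (α/p)^j {∞, ·}_h` that only the untwist `g`'s own integrality sees (module docstring of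
  `CyclotomicUntwistUntwistedSymbolSystem`).

References: [cite: MazurTateTeitelbaum1986Invent, §I.11 (measures vs. distributions) and §I.14];
[cite: Bellaiche2021, Def. 6.2.10, Thm. 6.7.9].
-/

noncomputable section

open scoped MatrixGroups

open CongruenceSubgroup DirichletCharacter Literature.NumberTheory.EllipticCurves
  Literature.NumberTheory.EllipticCurves.ModularForms Literature.NumberTheory.IwasawaTheory
  Summit.BirchSwinnertonDyer.BirchSwinnertonDyer.Theorems.PSF1Reduction

-- single-conjunct summit: `Summit.BirchSwinnertonDyer.BirchSwinnertonDyer.…` repeats the name by design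
set_option linter.dupNamespace false
set_option autoImplicit false

namespace Summit.BirchSwinnertonDyer.BirchSwinnertonDyer.Theorems.PSF1Curve

/-! ### §1 Curve level (`p = 3`, `c = 2`) -/

section Curve

variable {W : WeierstrassCurve ℚ} {N : ℕ} [NeZero N] {f : CuspForm (Gamma0 N) 2}
variable (η : DirichletCharacter ℂ_[3] (3 ^ 2)) (α : ℂ_[3])
variable (S : (j : ℕ) → ZMod (3 ^ j) → ℂ_[3])
variable (hS : ∀ (j : ℕ) (y : ZMod (3 ^ j)), S j y = ∑ b : ZMod (3 ^ 2), η b *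
  algebraMap ℚ ℂ_[3] (ratPlusSymbol f ((y.val : ℚ) / (3 : ℚ) ^ j + (b.val : ℚ) / (3 : ℚ) ^ 2)))
variable (ν : (M : ℕ) → ZMod (3 ^ M) → ℂ_[3])
variable (hν : ∀ (M : ℕ) (x : ZMod (3 ^ M)), ν M x =
  (∑ i ∈ Finset.range M, α⁻¹ ^ (i + 1) * (((3 : ℕ) : ℂ_[3]) ^ (i + 1) / ((3 : ℕ) : ℂ_[3]) ^ M) *
      S (i + 1) ((x.val : ℕ) : ZMod (3 ^ (i + 1)))) +
    (((3 : ℕ) : ℂ_[3]) ^ M)⁻¹ * (1 - α / (3 : ℕ))⁻¹ * S 0 0)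
variable (ρ : (M : ℕ) → ZMod (3 ^ M) → ℂ_[3])
variable (hρ : ∀ (M : ℕ) (y : ZMod (3 ^ M)), ρ M y = η⁻¹ ((y.val : ℕ) : ZMod (3 ^ 2)) * ν M y)
variable (𝓛 : (n : ℕ) → ZMod (3 ^ n) → ℂ_[3])
variable (h𝓛 : ∀ (n : ℕ) (s : ZMod (3 ^ n)), 𝓛 n s =
  ∑ᶠ T : rootsOfUnity (torsionOrder 3) ℤ_[3],
    ∑ y ∈ Finset.univ.filter (fun y : ZMod (3 ^ (2 + cyclotomicExponent 3 + n)) ↦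
      ZMod.castHom (pow_dvd_pow 3 (by omega : cyclotomicExponent 3 + n ≤ 2 + cyclotomicExponent 3 + n))
          (ZMod (3 ^ (cyclotomicExponent 3 + n))) y =
        PadicInt.toZModPow (cyclotomicExponent 3 + n) ((T : ℤ_[3]ˣ) : ℤ_[3]) *
          (cyclotomicGenerator 3 : ZMod (3 ^ (cyclotomicExponent 3 + n))) ^ s.val),
      ρ (2 + cyclotomicExponent 3 + n) y)

include hS hν hρ h𝓛 in
/-- **The route's D1 predicate from growth alone.** For the newform `f` of `W` (`IsNewformOf W f`), `η`
primitive mod `9`, `α ∉ {0, 3}` and the explicit untwisted candidate `𝓛` (`CyclotomicUntwistF1OfGrowth`,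
`p = 3`, `c = 2`): `HasGrowthOrder 3 ½ 𝓛 → IsPSCyclotomicLFunctionOf W η α 𝓛`.
[cite: MazurTateTeitelbaum1986Invent, §I.14 (case p ∣ N)] -/
theorem isPSCyclotomicLFunctionOf_of_hasGrowthOrder (hf : IsNewformOf W f) (hη : η.IsPrimitive)
    (hα : α ≠ 0) (hα3 : α ≠ (3 : ℕ)) (hgrowth : HasGrowthOrder 3 (1 / 2) 𝓛) :
    IsPSCyclotomicLFunctionOf W η α 𝓛 :=
  ⟨N, inferInstance, f, hf,
    isUntwistedPAdicLFunction_of_hasGrowthOrder (p := 3) f η α S hS ν hν ρ hρ 𝓛 h𝓛 (by norm_num) hη hα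
      hα3 hgrowth⟩

end Curve

/-! ### §2 The formal bound: growth order ONE from bounded symbols -/

section OrderOne

variable {p : ℕ} [Fact p.Prime]
variable {N : ℕ} [NeZero N] (f : CuspForm (Gamma0 N) 2)
variable {c : ℕ} (η : DirichletCharacter ℂ_[p] (p ^ c)) (α : ℂ_[p])
variable (S : (j : ℕ) → ZMod (p ^ j) → ℂ_[p])
variable (hS : ∀ (j : ℕ) (y : ZMod (p ^ j)), S j y = ∑ b : ZMod (p ^ c), η b *
  algebraMap ℚ ℂ_[p] (ratPlusSymbol f ((y.val : ℚ) / (p : ℚ) ^ j + (b.val : ℚ) / (p : ℚ) ^ c)))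
variable (ν : (M : ℕ) → ZMod (p ^ M) → ℂ_[p])
variable (hν : ∀ (M : ℕ) (x : ZMod (p ^ M)), ν M x =
  (∑ i ∈ Finset.range M, α⁻¹ ^ (i + 1) * ((p : ℂ_[p]) ^ (i + 1) / (p : ℂ_[p]) ^ M) *
      S (i + 1) ((x.val : ℕ) : ZMod (p ^ (i + 1)))) +
    ((p : ℂ_[p]) ^ M)⁻¹ * (1 - α / p)⁻¹ * S 0 0)
variable (ρ : (M : ℕ) → ZMod (p ^ M) → ℂ_[p])
variable (hρ : ∀ (M : ℕ) (y : ZMod (p ^ M)), ρ M y = η⁻¹ ((y.val : ℕ) : ZMod (p ^ c)) * ν M y)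
variable (𝓛 : (n : ℕ) → ZMod (p ^ n) → ℂ_[p])
variable (h𝓛 : ∀ (n : ℕ) (s : ZMod (p ^ n)), 𝓛 n s =
  ∑ᶠ T : rootsOfUnity (torsionOrder p) ℤ_[p],
    ∑ y ∈ Finset.univ.filter (fun y : ZMod (p ^ (c + cyclotomicExponent p + n)) ↦
      ZMod.castHom (pow_dvd_pow p (by omega : cyclotomicExponent p + n ≤ c + cyclotomicExponent p + n))
          (ZMod (p ^ (cyclotomicExponent p + n))) y =
        PadicInt.toZModPow (cyclotomicExponent p + n) ((T : ℤ_[p]ˣ) : ℤ_[p]) *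
          (cyclotomicGenerator p : ZMod (p ^ (cyclotomicExponent p + n))) ^ s.val),
      ρ (c + cyclotomicExponent p + n) y)
variable {B : ℝ} (hB : ∀ r : ℚ, ‖algebraMap ℚ ℂ_[p] (ratPlusSymbol f r)‖ ≤ B)

/-- `‖p^k‖ = p^{-k}` in `ℂ_p`. [folklore] -/
theorem norm_p_pow (k : ℕ) : ‖((p : ℂ_[p]) ^ k)‖ = ((p : ℝ) ^ k)⁻¹ := by
  have h : ‖((p : ℕ) : ℂ_[p])‖ = ((p : ℕ) : ℝ)⁻¹ := by
    rw [← map_natCast (algebraMap ℚ_[p] ℂ_[p]) p, norm_algebraMap', Padic.norm_p]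
  rw [norm_pow, h, inv_pow]

include hS hB in
omit [NeZero N] in
/-- **The untwisted symbols are bounded**: `‖S_j(y)‖ ≤ B` (ultrametric; `‖η(b)‖ ≤ 1`). [folklore] -/
theorem norm_S_le (j : ℕ) (y : ZMod (p ^ j)) : ‖S j y‖ ≤ B := by
  rw [hS]
  refine IsUltrametricDist.norm_sum_le_of_forall_le_of_nonneg ((norm_nonneg _).trans (hB 0)) fun b _ ↦ ?_
  rw [norm_mul]
  exact (mul_le_of_le_one_left (norm_nonneg _) (η.norm_le_one b)).trans (hB _)

include hS hν hB in
omit [NeZero N] in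
/-- **`ν` has order one**: `‖ν_M(x)‖ ≤ max(1, ‖(1 − α/p)⁻¹‖) · B · p^M` when `‖p‖ ≤ ‖α‖` (slope `≤ 1`).
[cite: MazurTateTeitelbaum1986Invent, §I.11] -/
theorem norm_nu_le (hαp : ‖(p : ℂ_[p])‖ ≤ ‖α‖) (M : ℕ) (x : ZMod (p ^ M)) :
    ‖ν M x‖ ≤ max 1 ‖(1 - α / p)⁻¹‖ * B * (p : ℝ) ^ M := by
  have hp : p.Prime := Fact.out
  have hp0 : (0 : ℝ) < p := by exact_mod_cast hp.pos
  have hB0 : 0 ≤ B := (norm_nonneg _).trans (hB 0)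
  have hα0 : α ≠ 0 := by
    intro h
    rw [h, norm_zero] at hαp
    exact absurd hαp (not_le.mpr (norm_pos_iff.mpr (Nat.cast_ne_zero.mpr hp.ne_zero)))
  have hK : 0 ≤ max 1 ‖(1 - α / p)⁻¹‖ * B * (p : ℝ) ^ M := by positivity
  -- `‖α⁻¹ p‖ ≤ 1`
  have hq : ‖α⁻¹ * (p : ℂ_[p])‖ ≤ 1 := by
    rw [norm_mul, norm_inv, inv_mul_le_iff₀ (norm_pos_iff.mpr hα0), mul_one]
    exact hαp
  rw [hν]
  refine (IsUltrametricDist.norm_add_le_max _ _).trans ?_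
  have h1 : ‖∑ i ∈ Finset.range M, α⁻¹ ^ (i + 1) * ((p : ℂ_[p]) ^ (i + 1) / (p : ℂ_[p]) ^ M) *
      S (i + 1) ((x.val : ℕ) : ZMod (p ^ (i + 1)))‖ ≤ B * (p : ℝ) ^ M := by
    refine IsUltrametricDist.norm_sum_le_of_forall_le_of_nonneg (by positivity) fun i _ ↦ ?_
    rw [norm_mul, show α⁻¹ ^ (i + 1) * ((p : ℂ_[p]) ^ (i + 1) / (p : ℂ_[p]) ^ M) =
      (α⁻¹ * (p : ℂ_[p])) ^ (i + 1) * ((p : ℂ_[p]) ^ M)⁻¹ by rw [mul_pow, div_eq_mul_inv, mul_assoc],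
      norm_mul, norm_inv, norm_p_pow, inv_inv, norm_pow]
    calc ‖α⁻¹ * (p : ℂ_[p])‖ ^ (i + 1) * (p : ℝ) ^ M * ‖S (i + 1) ((x.val : ℕ) : ZMod (p ^ (i + 1)))‖
        ≤ 1 * (p : ℝ) ^ M * B := by
          gcongr
          · exact pow_le_one₀ (norm_nonneg _) hq
          · exact norm_S_le f η S hS hB _ _
      _ = B * (p : ℝ) ^ M := by ring
  have h2 : ‖((p : ℂ_[p]) ^ M)⁻¹ * (1 - α / p)⁻¹ * S 0 0‖ ≤ ‖(1 - α / p)⁻¹‖ * B * (p : ℝ) ^ M := by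
    rw [norm_mul, norm_mul, norm_inv, norm_p_pow, inv_inv]
    calc (p : ℝ) ^ M * ‖(1 - α / ↑p)⁻¹‖ * ‖S 0 0‖ ≤ (p : ℝ) ^ M * ‖(1 - α / ↑p)⁻¹‖ * B := by
          gcongr; exact norm_S_le f η S hS hB _ _
      _ = ‖(1 - α / p)⁻¹‖ * B * (p : ℝ) ^ M := by ring
  refine max_le (h1.trans ?_) (h2.trans ?_)
  · calc B * (p : ℝ) ^ M = 1 * B * (p : ℝ) ^ M := by ring
      _ ≤ max 1 ‖(1 - α / p)⁻¹‖ * B * (p : ℝ) ^ M := by gcongr; exact le_max_left _ _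
  · gcongr; exact le_max_right _ _

include hS hν hρ h𝓛 hB in
omit [NeZero N] in
/-- **The explicit candidate has growth order ONE** (from bounded symbols and slope `≤ 1` alone):
`‖𝓛 n s‖ ≤ (max(1, ‖(1−α/p)⁻¹‖) · B · p^{c+e₀}) · p^n`. D1 asks for order `½`; that half step is F1.
[cite: MazurTateTeitelbaum1986Invent, §I.11] [cite: Bellaiche2021, Def. 6.2.10] -/
theorem hasGrowthOrder_one_candidate (hαp : ‖(p : ℂ_[p])‖ ≤ ‖α‖) : HasGrowthOrder p 1 𝓛 := by
  classical
  haveI := neZero_torsionOrder p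
  haveI := Fintype.ofFinite (rootsOfUnity (torsionOrder p) ℤ_[p])
  have hp : p.Prime := Fact.out
  have hp0 : (0 : ℝ) < p := by exact_mod_cast hp.pos
  have hB0 : 0 ≤ B := (norm_nonneg _).trans (hB 0)
  set K : ℝ := max 1 ‖(1 - α / p)⁻¹‖ * B with hK
  have hK0 : 0 ≤ K := by positivity
  refine ⟨K * (p : ℝ) ^ (c + cyclotomicExponent p), fun n s ↦ ?_⟩
  have hρle : ∀ y : ZMod (p ^ (c + cyclotomicExponent p + n)),
      ‖ρ (c + cyclotomicExponent p + n) y‖ ≤ K * (p : ℝ) ^ (c + cyclotomicExponent p + n) := by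
    intro y
    rw [hρ, norm_mul]
    calc ‖η⁻¹ ((y.val : ℕ) : ZMod (p ^ c))‖ * ‖ν (c + cyclotomicExponent p + n) y‖
        ≤ 1 * (max 1 ‖(1 - α / p)⁻¹‖ * B * (p : ℝ) ^ (c + cyclotomicExponent p + n)) :=
          mul_le_mul (η⁻¹.norm_le_one _) (norm_nu_le f η α S hS ν hν hB hαp _ y) (norm_nonneg _)
            zero_le_one
      _ = K * (p : ℝ) ^ (c + cyclotomicExponent p + n) := by rw [hK]; ring
  rw [h𝓛, finsum_eq_sum_of_fintype]
  have hbound : (0 : ℝ) ≤ K * (p : ℝ) ^ (c + cyclotomicExponent p + n) := by positivity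
  calc ‖_‖ ≤ K * (p : ℝ) ^ (c + cyclotomicExponent p + n) := by
        refine IsUltrametricDist.norm_sum_le_of_forall_le_of_nonneg hbound fun T _ ↦ ?_
        exact IsUltrametricDist.norm_sum_le_of_forall_le_of_nonneg hbound fun y _ ↦ hρle y
    _ = K * (p : ℝ) ^ (c + cyclotomicExponent p) * (p : ℝ) ^ ((1 : ℝ) * n) := by
        rw [one_mul, Real.rpow_natCast, pow_add]; ring

end OrderOne

end Summit.BirchSwinnertonDyer.BirchSwinnertonDyer.Theorems.PSF1Curve
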